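import Summits.AtomisticToContinuum.HydrodynamicLimit.Theorems.AntiMazurCoboundariesCellForecastPressureDecayKinematicAssemblyMainTerm
import Summits.AtomisticToContinuum.HydrodynamicLimit.Theorems.AntiMazurCoboundariesCellForecastPressureDecayKinematicAssemblyPairExchange
import HarnessLib

/-!
# S2d′ · kinematic assembly from the cluster tail, piece 4: the static pair estimate
# (registered sub-goal `stub_kinematicAssemblyOfTail_statics` of stub `stub_kinematicAssemblyOfTail`, crux line
# `enskog-compensator-martingale`, crux `CellForecastPressureDecay`, stmt-AtomisticToContinuum-13915)

The STATIC main term of the equal-time Enskog kinematics (`KinematicRates σ`, stub S2d′), pair by pair. Given the pair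
statistics `ContactStatistics` at `(L, n)` with its constant `c₂` (hypothesis `hCS`) and the contact-layer bound (a) of
`ContactLayerBounds` (hypothesis `hCLB`), for every pair of velocities `(v, u)` and every pair functional `φ` supported in
the shell `σ ≤ ‖q‖ ≤ σ + Δ‖v − u‖`, `|φ| ≤ 4b`, `∫ φ = σ²Δ · K_w(v, u)` (`stub_kinematicAssembly_mainTerm`):

`|E_pos φ(x_a − x_b) − (c₂ σ² Δ / n(n−1)) K_w(v, u)| ≤ E₀ · (1 + ‖v − u‖)⁴`,

`E₀ = 4bC_CS(ΔL² + Δ²L³)/n(n−1) + 8bC_CLB Δ²/L³ + 4bπσ²K L³Δ²/n(n−1)`: for `Δ‖v − u‖ ≤ 1` the pair statistics apply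
to `φ/4b` (exchangeability `sum_integral_posLaw_pair` turns their double sum into `n(n−1)` copies of the pair `(a, b)`);
for the Gaussian-rare fast pairs `Δ‖v − u‖ > 1` both terms are bounded separately by the contact-layer bound and the
collision frequency `|K_w(v, u)| ≤ 4bπ‖v − u‖`, granted an a-priori bound `c₂ ≤ K L³` (`c₂_le`: test the pair statistics
with the indicator of the unit shell). Also: the pair kernel is measurable along measurable velocity maps (`measurable_pairKernel_comp`).

References: Cercignani–Illner–Pulvirenti 1994, §2.2, §4.3; Ruelle 1969, §4.2.
-/

noncomputable section

open MeasureTheory ProbabilityTheory Set Filter Topology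
open scoped ENNReal BigOperators InnerProductSpace
open Literature.Analysis.FluidPDE Literature.MathematicalPhysics.KineticTheory

namespace Summit.AtomisticToContinuum.HydrodynamicLimit.Theorems.EnskogCompensator

/-! ## The pair kernel is jointly measurable -/

/-- **The Enskog–Boltzmann pair kernel `K_w(f, g)` is measurable** along any two measurable velocity maps `f, g`, for
continuous `w` (a parametric integral over the finite sphere measure of a jointly measurable integrand). [folklore] -/
theorem measurable_pairKernel_comp {α : Type*} [MeasurableSpace α] {w : V3 → ℝ} (hw : Continuous w)
    {f g : α → V3} (hf : Measurable f) (hg : Measurable g) :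
    Measurable fun a => pairKernel w (f a) (g a) := by
  haveI := isFiniteMeasure_sphereMeasure (E := V3)
  have hwm : Measurable w := hw.measurable
  have h := StronglyMeasurable.integral_prod_right' (ν := sphereMeasure)
    (f := fun q : α × Metric.sphere (0 : V3) 1 => hardSphereKernel (f q.1, g q.1) q.2 *
      (w (collide q.2 (f q.1, g q.1)).1 + w (collide q.2 (f q.1, g q.1)).2 - w (f q.1) - w (g q.1))) ?_
  · exact h.measurable
  · refine Measurable.stronglyMeasurable ?_
    unfold hardSphereKernel collide
    dsimp only
    fun_prop

/-! ## Elementary inequalities -/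

/-- `s ≤ (1 + s)⁴`, `s² ≤ (1 + s)⁴`, `s³ ≤ (1 + s)⁴` for `s ≥ 0`. [folklore] -/
theorem pow_le_one_add_pow_four {s : ℝ} (hs : 0 ≤ s) :
    s ≤ (1 + s) ^ 4 ∧ s ^ 2 ≤ (1 + s) ^ 4 ∧ s ^ 3 ≤ (1 + s) ^ 4 := by
  have h1 : 1 ≤ 1 + s := by linarith
  have h2 : s ≤ 1 + s := by linarith
  refine ⟨?_, ?_, ?_⟩
  · calc s ≤ (1 + s) ^ 1 := by linarith
      _ ≤ (1 + s) ^ 4 := pow_le_pow_right₀ h1 (by norm_num)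
  · calc s ^ 2 ≤ (1 + s) ^ 2 := pow_le_pow_left₀ hs h2 2
      _ ≤ (1 + s) ^ 4 := pow_le_pow_right₀ h1 (by norm_num)
  · calc s ^ 3 ≤ (1 + s) ^ 3 := pow_le_pow_left₀ hs h2 3
      _ ≤ (1 + s) ^ 4 := pow_le_pow_right₀ h1 (by norm_num)

/-- Two distinct labels force `n ≥ 2`, so `n(n − 1) > 0`. [folklore] -/
theorem cast_mul_pred_pos {n : ℕ} {a c : Fin n} (hac : a ≠ c) : (0 : ℝ) < n * (n - 1) := by
  have h2 : 2 ≤ n := by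
    by_contra hlt
    have : a.val = c.val := by omega
    exact hac (Fin.ext this)
  have h2' : (2 : ℝ) ≤ n := by exact_mod_cast h2
  nlinarith

/-! ## Measurability and boundedness of the static pair sum -/

section PairSum

variable {n : ℕ}

/-- The static pair sum `∑_{i≠j} φ_{vᵢ,vⱼ}(xᵢ − xⱼ)` is measurable in the datum for a jointly measurable family `φ`.
[folklore] -/
theorem measurable_pairSum {φ : V3 → V3 → V3 → ℝ} (hφm : Measurable fun p : V3 × V3 × V3 => φ p.1 p.2.1 p.2.2) :
    Measurable fun z : Cell n => ∑ i, ∑ j, (if i = j then 0 else φ (z i).2 (z j).2 ((z i).1 - (z j).1)) := by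
  refine Finset.measurable_sum _ fun i _ => Finset.measurable_sum _ fun j _ => ?_
  refine Measurable.ite (MeasurableSet.const _) measurable_const ?_
  exact hφm.comp ((measurable_pi_apply i).snd.prodMk ((measurable_pi_apply j).snd.prodMk
    ((measurable_pi_apply i).fst.sub (measurable_pi_apply j).fst)))

/-- The static pair sum is bounded by `4b n²`. [folklore] -/
theorem abs_pairSum_le {φ : V3 → V3 → V3 → ℝ} {b : ℝ} (hφb : ∀ v u q, |φ v u q| ≤ 4 * b) (z : Cell n) :
    |∑ i, ∑ j, (if i = j then 0 else φ (z i).2 (z j).2 ((z i).1 - (z j).1))| ≤ 4 * b * (n * n) := by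
  have hb : 0 ≤ 4 * b := (abs_nonneg _).trans (hφb 0 0 0)
  calc |∑ i, ∑ j, (if i = j then 0 else φ (z i).2 (z j).2 ((z i).1 - (z j).1))|
      ≤ ∑ i, |∑ j, (if i = j then 0 else φ (z i).2 (z j).2 ((z i).1 - (z j).1))| := Finset.abs_sum_le_sum_abs _ _
    _ ≤ ∑ i, ∑ j, |(if i = j then 0 else φ (z i).2 (z j).2 ((z i).1 - (z j).1))| :=
        Finset.sum_le_sum fun i _ => Finset.abs_sum_le_sum_abs _ _
    _ ≤ ∑ _i : Fin n, ∑ _j : Fin n, 4 * b := Finset.sum_le_sum fun i _ => Finset.sum_le_sum fun j _ => by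
        split_ifs
        · rw [abs_zero]; exact hb
        · exact hφb _ _ _
    _ = 4 * b * (n * n) := by
        simp only [Finset.sum_const, Finset.card_univ, Fintype.card_fin, nsmul_eq_mul]
        ring

end PairSum

/-! ## The a-priori bound on the contact constant -/

/-- **The contact constant of the pair statistics is at most `K L³`**: testing `ContactStatistics` with the indicator
of the unit shell `σ ≤ ‖q‖ ≤ σ + 1` (`r = 1`) and bounding each pair probability by the contact-layer bound gives
`c₂ · vol(shell) ≤ 8 C_CLB L³ + 2 C_CS L³`, and the shell contains a ball of radius `1/2`. [folklore] -/
theorem c₂_le {σ L : ℝ} {n : ℕ} (hσ : 0 < σ) (hL : 1 ≤ L) (hn : (n : ℝ) ≤ 2 * L ^ 3) {C_CS c₂ C_CLB : ℝ}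
    (hCS0 : 0 ≤ C_CS) (hCLB0 : 0 ≤ C_CLB)
    (hCS : ∀ r : ℝ, 0 ≤ r → r ≤ 1 → ∀ ψ : V3 → ℝ, Measurable ψ → (∀ q, |ψ q| ≤ 1) →
      (∀ q, ψ q ≠ 0 → σ ≤ ‖q‖ ∧ ‖q‖ ≤ σ + r) →
        |(∑ i : Fin n, ∑ j : Fin n, if i = j then 0 else ∫ x, ψ (x i - x j) ∂(posLaw σ L n)) - c₂ * ∫ q, ψ q| ≤
          C_CS * (r * L ^ 2 + r ^ 2 * L ^ 3))
    (hCLB : ∀ r : ℝ, 0 ≤ r → ∀ i j : Fin n, i ≠ j →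
      posLaw σ L n {x | ‖x i - x j‖ ≤ σ + r} ≤ ENNReal.ofReal (C_CLB * (r + r ^ 3) / L ^ 3))
    [IsFiniteMeasure (posLaw σ L n)] :
    c₂ ≤ (8 * C_CLB + 2 * C_CS) / (volume (Metric.ball (0 : V3) (1 / 2))).toReal * L ^ 3 := by
  have hL0 : 0 < L := by linarith
  set S : Set V3 := {q | σ ≤ ‖q‖ ∧ ‖q‖ ≤ σ + 1} with hS
  have hSm : MeasurableSet S := (measurableSet_le measurable_const measurable_norm).inter
    (measurableSet_le measurable_norm measurable_const)
  set ψ : V3 → ℝ := S.indicator 1 with hψ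
  have hψm : Measurable ψ := measurable_one.indicator hSm
  have hψ1 : ∀ q, |ψ q| ≤ 1 := fun q => by
    by_cases hq : q ∈ S
    · simp [hψ, indicator_of_mem hq]
    · simp [hψ, indicator_of_notMem hq]
  have hψs : ∀ q, ψ q ≠ 0 → σ ≤ ‖q‖ ∧ ‖q‖ ≤ σ + 1 := fun q hq => by
    have h : q ∈ S := Set.mem_of_indicator_ne_zero hq
    exact h
  have h1 := hCS 1 zero_le_one le_rfl ψ hψm hψ1 hψs
  -- the double sum is at most `8 C_CLB L³`
  have hterm : ∀ i j : Fin n, (if i = j then 0 else ∫ x, ψ (x i - x j) ∂(posLaw σ L n)) ≤ 2 * C_CLB / L ^ 3 := by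
    intro i j
    split_ifs with hij
    · positivity
    · set T : Set (Fin n → V3) := {x | ‖x i - x j‖ ≤ σ + 1} with hT
      have hTm : MeasurableSet T :=
        measurableSet_le ((measurable_pi_apply i).sub (measurable_pi_apply j)).norm measurable_const
      have hle : ∀ x, ψ (x i - x j) ≤ T.indicator 1 x := fun x => by
        by_cases hx : x i - x j ∈ S
        · have hxT : x ∈ T := hx.2
          simp [hψ, indicator_of_mem hx, indicator_of_mem hxT]
        · simp only [hψ, indicator_of_notMem hx]
          exact Set.indicator_nonneg (fun _ _ => zero_le_one) _
      calc ∫ x, ψ (x i - x j) ∂(posLaw σ L n) ≤ ∫ x, T.indicator 1 x ∂(posLaw σ L n) := by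
            refine integral_mono_of_nonneg (ae_of_all _ fun x => ?_) ((integrable_const (1 : ℝ)).indicator hTm)
              (ae_of_all _ hle)
            exact Set.indicator_nonneg (fun _ _ => zero_le_one) _
        _ = (posLaw σ L n).real T := integral_indicator_one hTm
        _ ≤ C_CLB * (1 + 1 ^ 3) / L ^ 3 := by
            rw [measureReal_def]
            exact ENNReal.toReal_le_of_le_ofReal (by positivity) (hCLB 1 zero_le_one i j hij)
        _ = 2 * C_CLB / L ^ 3 := by ring
  have hsum : (∑ i : Fin n, ∑ j : Fin n, if i = j then 0 else ∫ x, ψ (x i - x j) ∂(posLaw σ L n)) ≤ 8 * C_CLB * L ^ 3 := by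
    calc (∑ i : Fin n, ∑ j : Fin n, if i = j then 0 else ∫ x, ψ (x i - x j) ∂(posLaw σ L n))
        ≤ ∑ _i : Fin n, ∑ _j : Fin n, 2 * C_CLB / L ^ 3 :=
          Finset.sum_le_sum fun i _ => Finset.sum_le_sum fun j _ => hterm i j
      _ = (n : ℝ) * n * (2 * C_CLB / L ^ 3) := by
          simp only [Finset.sum_const, Finset.card_univ, Fintype.card_fin, nsmul_eq_mul]; ring
      _ ≤ (2 * L ^ 3) * (2 * L ^ 3) * (2 * C_CLB / L ^ 3) := by gcongr
      _ = 8 * C_CLB * L ^ 3 := by field_simp; ring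
  -- the shell contains a ball of radius `1/2`
  obtain ⟨p₀, hp₀n⟩ : ∃ p₀ : V3, ‖p₀‖ = σ + 1 / 2 := exists_norm_eq V3 (by positivity)
  have hball : Metric.ball p₀ (1 / 2) ⊆ S := fun q hq => by
    rw [Metric.mem_ball, dist_eq_norm] at hq
    constructor
    · have := norm_sub_norm_le p₀ q
      rw [norm_sub_rev] at this
      linarith
    · have := norm_le_norm_add_norm_sub' q p₀
      linarith
  have hvol_pos : 0 < (volume (Metric.ball (0 : V3) (1 / 2))).toReal :=
    ENNReal.toReal_pos (Metric.measure_ball_pos volume _ (by norm_num)).ne' measure_ball_lt_top.ne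
  have hint : (volume (Metric.ball (0 : V3) (1 / 2))).toReal ≤ ∫ q, ψ q := by
    rw [hψ, integral_indicator_one hSm, measureReal_def, ← Measure.addHaar_ball_center volume p₀]
    have hSfin : volume S < ⊤ := by
      refine lt_of_le_of_lt (measure_mono (fun q hq => ?_)) (measure_closedBall_lt_top (x := (0 : V3)) (r := σ + 1))
      rw [Metric.mem_closedBall, dist_zero_right]
      exact hq.2
    exact ENNReal.toReal_mono hSfin.ne (measure_mono hball)
  -- combine
  have hL23 : L ^ 2 ≤ L ^ 3 := pow_le_pow_right₀ hL (by norm_num)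
  have hc₂I : c₂ * ∫ q, ψ q ≤ (8 * C_CLB + 2 * C_CS) * L ^ 3 := by
    have h2 := (abs_sub_le_iff.1 h1).2
    have h3 := mul_le_mul_of_nonneg_left hL23 hCS0
    nlinarith
  -- either `c₂ ≤ 0` (trivial) or divide
  rcases le_or_gt c₂ 0 with hc | hc
  · exact hc.trans (by positivity)
  · rw [div_mul_eq_mul_div, le_div_iff₀ hvol_pos]
    calc c₂ * (volume (Metric.ball (0 : V3) (1 / 2))).toReal ≤ c₂ * ∫ q, ψ q :=
          mul_le_mul_of_nonneg_left hint hc.le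
      _ ≤ (8 * C_CLB + 2 * C_CS) * L ^ 3 := hc₂I

/-! ## The static pair estimate -/

/-- Expectations under the position law of a pair functional bounded by `B ≥ 0` and supported where
`‖x_a − x_b‖ ≤ σ + r` are at most `B · posLaw{‖x_a − x_b‖ ≤ σ + r}`. [folklore] -/
theorem abs_integral_posLaw_pair_le {σ L : ℝ} {n : ℕ} [IsFiniteMeasure (posLaw σ L n)] {φ : V3 → ℝ} {B r : ℝ}
    (hφb : ∀ q, |φ q| ≤ B) (hφs : ∀ q, φ q ≠ 0 → ‖q‖ ≤ σ + r) (a c : Fin n) :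
    |∫ x, φ (x a - x c) ∂(posLaw σ L n)| ≤ B * (posLaw σ L n).real {x | ‖x a - x c‖ ≤ σ + r} := by
  set T : Set (Fin n → V3) := {x | ‖x a - x c‖ ≤ σ + r} with hT
  have hTm : MeasurableSet T :=
    measurableSet_le ((measurable_pi_apply a).sub (measurable_pi_apply c)).norm measurable_const
  have hle : ∀ x, |φ (x a - x c)| ≤ T.indicator (fun _ => B) x := fun x => by
    by_cases hx : x ∈ T
    · rw [indicator_of_mem hx]; exact hφb _
    · rw [indicator_of_notMem hx]
      have h0 : φ (x a - x c) = 0 := by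
        by_contra h
        exact hx (hφs _ h)
      rw [h0, abs_zero]
  calc |∫ x, φ (x a - x c) ∂(posLaw σ L n)| ≤ ∫ x, |φ (x a - x c)| ∂(posLaw σ L n) := abs_integral_le_integral_abs
    _ ≤ ∫ x, T.indicator (fun _ => B) x ∂(posLaw σ L n) :=
        integral_mono_of_nonneg (ae_of_all _ fun x => abs_nonneg _) ((integrable_const B).indicator hTm)
          (ae_of_all _ hle)
    _ = B * (posLaw σ L n).real T := by rw [integral_indicator_const _ hTm, smul_eq_mul, mul_comm]

/-- **Registered sub-goal `stub_kinematicAssemblyOfTail_statics`** (piece of stub `stub_kinematicAssemblyOfTail`, S2d′,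
of the line `enskog-compensator-martingale`): **the static pair estimate.** At a cell `(L, n)` (`L ≥ 1`, `n ≤ 2L³`,
position law a probability measure) let `c₂ ≥ 0`, `C_CS ≥ 0` satisfy the pair statistics `ContactStatistics` and
`C_CLB ≥ 0` the contact-layer bound (a) of `ContactLayerBounds`, and let `c₂ ≤ K L³`. Then for `|w| ≤ b`, a slab
`0 < Δ ≤ 1`, velocities `(v, u)`, and a measurable pair functional `φ` with `|φ| ≤ 4b`, supported in
`σ ≤ ‖q‖ ≤ σ + Δ‖v − u‖`, `∫ φ = σ²Δ K_w(v, u)` (`stub_kinematicAssembly_mainTerm`), for every ordered pair `a ≠ b`: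
`|E_pos φ(x_a − x_b) − (c₂σ²Δ / n(n−1)) K_w(v, u)| ≤ E₀ (1 + ‖v − u‖)⁴` with
`E₀ = 4bC_CS(ΔL² + Δ²L³)/n(n−1) + 8bC_CLBΔ²/L³ + 4bπσ²KL³Δ²/n(n−1)` — pair statistics and exchangeability for the
slow pairs `Δ‖v − u‖ ≤ 1`, contact-layer bound and collision frequency for the fast ones. [cite: CIP1994, §4.3] -/
theorem stub_kinematicAssemblyOfTail_statics : ∀ (σ L : ℝ) (n : ℕ) (C_CS c₂ C_CLB K b Δ : ℝ) (w : V3 → ℝ) (v u : V3)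
    (φ : V3 → ℝ) (a c : Fin n), 0 < σ → 1 ≤ L → (n : ℝ) ≤ 2 * L ^ 3 → IsProbabilityMeasure (posLaw σ L n) →
    0 ≤ C_CS → 0 ≤ c₂ → 0 ≤ C_CLB →
    (∀ r : ℝ, 0 ≤ r → r ≤ 1 → ∀ ψ : V3 → ℝ, Measurable ψ → (∀ q, |ψ q| ≤ 1) →
      (∀ q, ψ q ≠ 0 → σ ≤ ‖q‖ ∧ ‖q‖ ≤ σ + r) →
        |(∑ i : Fin n, ∑ j : Fin n, if i = j then 0 else ∫ x, ψ (x i - x j) ∂(posLaw σ L n)) - c₂ * ∫ q, ψ q| ≤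
          C_CS * (r * L ^ 2 + r ^ 2 * L ^ 3)) →
    (∀ r : ℝ, 0 ≤ r → ∀ i j : Fin n, i ≠ j →
      posLaw σ L n {x | ‖x i - x j‖ ≤ σ + r} ≤ ENNReal.ofReal (C_CLB * (r + r ^ 3) / L ^ 3)) →
    c₂ ≤ K * L ^ 3 → (∀ x, |w x| ≤ b) → 0 < Δ → Δ ≤ 1 → Measurable φ → (∀ q, |φ q| ≤ 4 * b) →
    (∀ q, φ q ≠ 0 → σ ≤ ‖q‖ ∧ ‖q‖ ≤ σ + Δ * ‖v - u‖) → ∫ q, φ q = σ ^ 2 * Δ * pairKernel w v u → a ≠ c →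
      |(∫ x, φ (x a - x c) ∂(posLaw σ L n)) - c₂ * σ ^ 2 * Δ / (n * (n - 1)) * pairKernel w v u| ≤
        (4 * b * C_CS * (Δ * L ^ 2 + Δ ^ 2 * L ^ 3) / (n * (n - 1)) + 8 * b * C_CLB * Δ ^ 2 / L ^ 3 +
          4 * b * Real.pi * σ ^ 2 * K * L ^ 3 * Δ ^ 2 / (n * (n - 1))) * (1 + ‖v - u‖) ^ 4 := by
  intro σ L n C_CS c₂ C_CLB K b Δ w v u φ a c hσ hL hn hP hCS0 hc₂ hCLB0 hCS hCLB hK hwb hΔ hΔ1 hφm hφb hφs hφi hac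
  have hb : 0 ≤ b := (abs_nonneg _).trans (hwb 0)
  have hL0 : 0 < L := by linarith
  have hN : (0 : ℝ) < n * (n - 1) := cast_mul_pred_pos hac
  have hKn : 0 ≤ K := by
    by_contra hK'
    have : K * L ^ 3 < 0 := mul_neg_of_neg_of_pos (not_le.1 hK') (by positivity)
    linarith
  set s : ℝ := ‖v - u‖ with hs
  have hs0 : 0 ≤ s := norm_nonneg _
  obtain ⟨hs1, hs2, hs3⟩ := pow_le_one_add_pow_four hs0
  have h14 : 0 ≤ (1 + s) ^ 4 := by positivity
  set r : ℝ := Δ * s with hr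
  have hr0 : 0 ≤ r := by positivity
  -- the three (nonnegative) coefficients
  set A₁ : ℝ := 4 * b * C_CS * (Δ * L ^ 2 + Δ ^ 2 * L ^ 3) / (n * (n - 1)) with hA₁
  set A₂ : ℝ := 8 * b * C_CLB * Δ ^ 2 / L ^ 3 with hA₂
  set A₃ : ℝ := 4 * b * Real.pi * σ ^ 2 * K * L ^ 3 * Δ ^ 2 / (n * (n - 1)) with hA₃
  have hA₁0 : 0 ≤ A₁ := by positivity
  have hA₂0 : 0 ≤ A₂ := by positivity
  have hA₃0 : 0 ≤ A₃ := by positivity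
  set I : ℝ := ∫ x, φ (x a - x c) ∂(posLaw σ L n) with hI
  rcases le_or_gt r 1 with hr1 | hr1
  · -- slow pairs: the pair statistics
    have hmain : |I - c₂ * σ ^ 2 * Δ / (n * (n - 1)) * pairKernel w v u| ≤
        4 * b * C_CS * (r * L ^ 2 + r ^ 2 * L ^ 3) / (n * (n - 1)) := by
      rcases hb.eq_or_lt with hb0 | hb0
      · -- `b = 0`: everything vanishes
        have hφ0 : ∀ q, φ q = 0 := fun q => by
          have := hφb q; rw [← hb0] at this; exact abs_nonpos_iff.1 (by linarith)
        have hI0 : I = 0 := by simp [hI, hφ0]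
        have hK0 : σ ^ 2 * Δ * pairKernel w v u = 0 := by rw [← hφi]; simp [hφ0]
        have hK0' : pairKernel w v u = 0 := by
          rcases mul_eq_zero.1 hK0 with h | h
          · exact absurd h (by positivity)
          · exact h
        rw [hI0, hK0', ← hb0]
        simp
      · set ψ : V3 → ℝ := fun q => φ q / (4 * b) with hψ
        have h4b : 0 < 4 * b := by positivity
        have hψm : Measurable ψ := hφm.div_const _
        have hψ1 : ∀ q, |ψ q| ≤ 1 := fun q => by
          rw [hψ, abs_div, abs_of_pos h4b, div_le_one h4b]; exact hφb q
        have hψs : ∀ q, ψ q ≠ 0 → σ ≤ ‖q‖ ∧ ‖q‖ ≤ σ + r := fun q hq => by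
          refine hφs q fun h => hq ?_
          simp [hψ, h]
        have hstat := hCS r hr0 hr1 ψ hψm hψ1 hψs
        rw [sum_integral_posLaw_pair σ L ψ hac] at hstat
        have hIψ : ∫ x, ψ (x a - x c) ∂(posLaw σ L n) = I / (4 * b) := by
          simp only [hψ, hI]; exact integral_div _ _
        have hψi : ∫ q, ψ q = σ ^ 2 * Δ * pairKernel w v u / (4 * b) := by
          simp only [hψ]; rw [integral_div, hφi]
        rw [hIψ, hψi] at hstat
        -- rescale by `4b / n(n−1)`
        have hscale : I - c₂ * σ ^ 2 * Δ / (n * (n - 1)) * pairKernel w v u =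
            (4 * b / (n * (n - 1))) * ((n : ℝ) * (n - 1) * (I / (4 * b)) -
              c₂ * (σ ^ 2 * Δ * pairKernel w v u / (4 * b))) := by
          set N : ℝ := (n : ℝ) * (n - 1) with hNdef
          have hN' : N ≠ 0 := hN.ne'
          have hb0' : b ≠ 0 := hb0.ne'
          field_simp
        rw [hscale, abs_mul, abs_of_pos (by positivity : (0 : ℝ) < 4 * b / (n * (n - 1)))]
        calc 4 * b / (n * (n - 1)) * |(n : ℝ) * (n - 1) * (I / (4 * b)) - c₂ * (σ ^ 2 * Δ * pairKernel w v u / (4 * b))|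
            ≤ 4 * b / (n * (n - 1)) * (C_CS * (r * L ^ 2 + r ^ 2 * L ^ 3)) :=
              mul_le_mul_of_nonneg_left hstat (by positivity)
          _ = 4 * b * C_CS * (r * L ^ 2 + r ^ 2 * L ^ 3) / (n * (n - 1)) := by ring
    refine hmain.trans ?_
    have hrr : r * L ^ 2 + r ^ 2 * L ^ 3 ≤ (Δ * L ^ 2 + Δ ^ 2 * L ^ 3) * (1 + s) ^ 4 := by
      have h1 : r * L ^ 2 ≤ Δ * L ^ 2 * (1 + s) ^ 4 := by
        rw [hr]
        calc Δ * s * L ^ 2 = Δ * L ^ 2 * s := by ring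
          _ ≤ Δ * L ^ 2 * (1 + s) ^ 4 := mul_le_mul_of_nonneg_left hs1 (by positivity)
      have h2 : r ^ 2 * L ^ 3 ≤ Δ ^ 2 * L ^ 3 * (1 + s) ^ 4 := by
        rw [hr]
        calc (Δ * s) ^ 2 * L ^ 3 = Δ ^ 2 * L ^ 3 * s ^ 2 := by ring
          _ ≤ Δ ^ 2 * L ^ 3 * (1 + s) ^ 4 := mul_le_mul_of_nonneg_left hs2 (by positivity)
      calc r * L ^ 2 + r ^ 2 * L ^ 3 ≤ Δ * L ^ 2 * (1 + s) ^ 4 + Δ ^ 2 * L ^ 3 * (1 + s) ^ 4 := add_le_add h1 h2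
        _ = (Δ * L ^ 2 + Δ ^ 2 * L ^ 3) * (1 + s) ^ 4 := by ring
    have hA23 : 0 ≤ (A₂ + A₃) * (1 + s) ^ 4 := by positivity
    calc 4 * b * C_CS * (r * L ^ 2 + r ^ 2 * L ^ 3) / (n * (n - 1))
        ≤ 4 * b * C_CS * ((Δ * L ^ 2 + Δ ^ 2 * L ^ 3) * (1 + s) ^ 4) / (n * (n - 1)) := by gcongr
      _ = A₁ * (1 + s) ^ 4 := by rw [hA₁]; ring
      _ ≤ A₁ * (1 + s) ^ 4 + (A₂ + A₃) * (1 + s) ^ 4 := le_add_of_nonneg_right hA23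
      _ = (A₁ + A₂ + A₃) * (1 + s) ^ 4 := by ring
  · -- fast pairs: both terms separately
    have hI : |I| ≤ A₂ * (1 + s) ^ 4 := by
      have h1 : |I| ≤ 4 * b * (posLaw σ L n).real {x | ‖x a - x c‖ ≤ σ + r} :=
        abs_integral_posLaw_pair_le hφb (fun q hq => (hφs q hq).2) a c
      have h2 : (posLaw σ L n).real {x | ‖x a - x c‖ ≤ σ + r} ≤ C_CLB * (r + r ^ 3) / L ^ 3 := by
        rw [measureReal_def]
        exact ENNReal.toReal_le_of_le_ofReal (by positivity) (hCLB r hr0 a c hac)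
      have h3 : r + r ^ 3 ≤ 2 * (Δ ^ 2 * (1 + s) ^ 4) := by
        have h30 : 1 ≤ r ^ 2 := by
          have := pow_le_pow_left₀ zero_le_one hr1.le 2
          rwa [one_pow] at this
        have h31 : r ≤ r ^ 3 := by
          calc r = r * 1 := (mul_one r).symm
            _ ≤ r * r ^ 2 := mul_le_mul_of_nonneg_left h30 hr0
            _ = r ^ 3 := by ring
        have h32 : r ^ 3 ≤ Δ ^ 2 * (1 + s) ^ 4 := by
          have hΔ32 : Δ ^ 3 ≤ Δ ^ 2 := pow_le_pow_of_le_one hΔ.le hΔ1 (by norm_num)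
          calc r ^ 3 = Δ ^ 3 * s ^ 3 := by rw [hr, mul_pow]
            _ ≤ Δ ^ 2 * s ^ 3 := mul_le_mul_of_nonneg_right hΔ32 (by positivity)
            _ ≤ Δ ^ 2 * (1 + s) ^ 4 := mul_le_mul_of_nonneg_left hs3 (by positivity)
        linarith
      calc |I| ≤ 4 * b * (posLaw σ L n).real {x | ‖x a - x c‖ ≤ σ + r} := h1
        _ ≤ 4 * b * (C_CLB * (r + r ^ 3) / L ^ 3) := mul_le_mul_of_nonneg_left h2 (by positivity)
        _ ≤ 4 * b * (C_CLB * (2 * (Δ ^ 2 * (1 + s) ^ 4)) / L ^ 3) := by gcongr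
        _ = A₂ * (1 + s) ^ 4 := by rw [hA₂]; ring
    have hKterm : |c₂ * σ ^ 2 * Δ / (n * (n - 1)) * pairKernel w v u| ≤ A₃ * (1 + s) ^ 4 := by
      have h1 := abs_pairKernel_le hwb v u
      have h2 : Δ * s ≤ Δ ^ 2 * (1 + s) ^ 4 := by
        have h20 : r ≤ r ^ 2 := by
          calc r = r * 1 := (mul_one r).symm
            _ ≤ r * r := mul_le_mul_of_nonneg_left hr1.le hr0
            _ = r ^ 2 := by ring
        calc Δ * s = r := rfl
          _ ≤ r ^ 2 := h20
          _ = Δ ^ 2 * s ^ 2 := by rw [hr]; ring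
          _ ≤ Δ ^ 2 * (1 + s) ^ 4 := mul_le_mul_of_nonneg_left hs2 (by positivity)
      rw [abs_mul, abs_of_nonneg (by positivity : (0 : ℝ) ≤ c₂ * σ ^ 2 * Δ / (n * (n - 1)))]
      calc c₂ * σ ^ 2 * Δ / (n * (n - 1)) * |pairKernel w v u|
          ≤ c₂ * σ ^ 2 * Δ / (n * (n - 1)) * (4 * b * (Real.pi * s)) := mul_le_mul_of_nonneg_left h1 (by positivity)
        _ = (4 * b * Real.pi * σ ^ 2 / (n * (n - 1))) * c₂ * (Δ * s) := by ring
        _ ≤ (4 * b * Real.pi * σ ^ 2 / (n * (n - 1))) * (K * L ^ 3) * (Δ ^ 2 * (1 + s) ^ 4) := by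
            gcongr
        _ = A₃ * (1 + s) ^ 4 := by rw [hA₃]; ring
    calc |I - c₂ * σ ^ 2 * Δ / (n * (n - 1)) * pairKernel w v u|
        ≤ |I| + |c₂ * σ ^ 2 * Δ / (n * (n - 1)) * pairKernel w v u| := abs_sub _ _
      _ ≤ A₂ * (1 + s) ^ 4 + A₃ * (1 + s) ^ 4 := add_le_add hI hKterm
      _ ≤ A₁ * (1 + s) ^ 4 + (A₂ * (1 + s) ^ 4 + A₃ * (1 + s) ^ 4) := le_add_of_nonneg_left (by positivity)
      _ = (A₁ + A₂ + A₃) * (1 + s) ^ 4 := by ring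

end Summit.AtomisticToContinuum.HydrodynamicLimit.Theorems.EnskogCompensator

end
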